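import Mathlib
import HarnessLib
import Summits.HubbardSuperconductivity.HubbardSuperconductivity.Theorems.KLProgrammeAbsUmklappTargetCount34FrameShell
import Summits.HubbardSuperconductivity.HubbardSuperconductivity.Theorems.KLProgrammeAbsUmklappTargetCount34Bound

/-!
# Route `KLProgramme` — K3 engine (stmt-HubbardSuperconductivity-20437), stub (b) (ℓ)/(I2)–(I3), located item «ABS-UMK-COUNT» / «ABS-UMK-34-SIGNPAT»:
# BGM 2003 Lemma 3.1 WITH A TARGET VECTOR, A PRESCRIBED NONEMPTY LEG SET AND ≥ 3 FREE LEGS, ABSOLUTE FORM, ON THE CURVE OF EVERY FRAME —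
# `≤ c^L · (n′ + 1) · 2^{n′(L−|E|−2)}`, no regime

Cell gate-hubbard-kl, seat p4 g16 (≥ 3-free-leg twin of `frame_count_target_abs_prescribed_shell`, p626442; pen (R180)(b) «ABS-UMK-34-SIGNPAT»: the cells of E1's
levelled `k′ = 0` summand with 3 or 4 free legs).  The regime-form frame discharger `frame_targetStrings34_uniform_shell` produces `κ` and the thirteen constants
ONCE for the level window and the shell; the cone radius is fixed at `Φ₀ = min(Φ/2, s₁Φ/(96(M₁+1)))`, the fine-scale regime `Q·L ≤ 2^{n′}` is closed by
`targetBound34_le_pow` (one logarithm `≤ n′ + 1`), the coarse regime by the free-leg count (`card_prescribed_le`, `coarse_bound_prescribed`):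

* **`frame_count_target_abs34_shell`** — for every window `[μ₁, μ₂]` with `-4 < μ₁ − 4e₀`, `μ₂ + 4e₀ < 0`: `∃ κ, c > 0` such that for EVERY frame `K` of `C²`
  size `A`, `4A ≤ κ`, EVERY `μ ∈ [μ₁, μ₂]`, all `n′`, `L`, every NONEMPTY leg set `E` with `|E| + 3 ≤ L`, prescribed labels `τ|_E` and EVERY target `R`:
  `Nat.card {ω : ω|_E = τ|_E, ∃ k_i ∈ S_{n′,ω_i}(frame chart, shell e₀), Σ k_i = R} ≤ c^L · (n′ + 1) · 2^{n′(L − |E| − 2)}`.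

Everything is PROVED; no definitions, no named facts. [cite: BenfattoGiulianiMastropietro2003, §3.1 Lemma 3.1 (4.3) p.17 and §7.4 p.28]
[cite: BenfattoGiulianiMastropietro2006, App. A3]
-/

noncomputable section

namespace Summit.HubbardSuperconductivity.HubbardSuperconductivity.Theorems.PerturbedFermiCurve

set_option linter.dupNamespace false -- summit = problem name (single-conjunct summit), D-0017

open Real Set
open Literature.MathematicalPhysics.QuantumLattice Literature.MathematicalPhysics.QuantumLattice.BandSectorCounting
open Literature.MathematicalPhysics.QuantumLattice.FermiRG Literature.MathematicalPhysics.QuantumLattice.FermiRG.BGM2003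
open Summit.HubbardSuperconductivity.HubbardSuperconductivity.Theorems.DispersionFlow
open Summit.HubbardSuperconductivity.HubbardSuperconductivity.Theorems.AbsUmklappCount

set_option maxHeartbeats 800000 in -- constants are large closed terms; many positivity/regime side goals (as in `count_target_abs_of_dispersionHyp`)
/-- **BGM 2003 Lemma 3.1 with a target vector, a prescribed nonempty leg set and ≥ 3 free legs, absolute form (one logarithm), on the curve of every frame of
small `C²` size, prescribed shell.**  See the module docstring. [cite: BenfattoGiulianiMastropietro2003, §3.1 Lemma 3.1 (4.3) p.17 (L46–58) and §7.4 p.28 (L6–125)] -/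
theorem frame_count_target_abs34_shell :
    ∀ μ₁ μ₂ e₀ : ℝ, 0 < e₀ → -4 < μ₁ - 4 * e₀ → μ₁ ≤ μ₂ → μ₂ + 4 * e₀ < 0 → ∃ κ : ℝ, 0 < κ ∧ ∃ c : ℝ, 0 < c ∧
      ∀ (K : TrigPolyC4v) (A : ℝ), (∀ p : Momentum, ∀ j ≤ 2, ‖iteratedFDeriv ℝ j (frameShift K) p‖ ≤ A) → 4 * A ≤ κ →
      ∀ μ ∈ Set.Icc μ₁ μ₂, ∀ (n' L : ℕ) (E : Finset (Fin L)), E.card + 3 ≤ L → ∀ s ∈ E, ∀ (τ : Fin L → Fin (sectorCount n')) (R : Fin 2 → ℝ),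
        (Nat.card {ω : Fin L → Fin (sectorCount n') |
            (∀ e ∈ E, ω e = τ e) ∧ ∃ k : Fin L → (Fin 2 → ℝ),
              (∀ i, k i ∈ BGM2003.sSector
                (fun ϑ e => perturbedFermiRadius (fun k : Fin 2 → ℝ => frameShift K (WithLp.toLp 2 k)) (μ + e) ϑ) e₀ n' (ω i : ℕ)) ∧
              ∑ i, k i = R} : ℝ) ≤ c ^ L * ((n' : ℝ) + 1) * (2 : ℝ) ^ (n' * (L - E.card - 2)) := by
  intro μ₁ μ₂ e₀ he₀ hμ₁ h12 hμ₂
  have hπ := Real.pi_pos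
  obtain ⟨κ, hκ, c₂, c₃, K₁, K₂, c₀, c₂', η₀, s₁, Φ, cf, Af, Bf, M₁, hc₂, hc₃, hK₁0, hK₂, hK₁c, hc₀, hc₂', hη₀, hs₁, hM₁, hΦ, hcf,
    hcfA, hBf, hcount⟩ := frame_targetStrings34_uniform_shell μ₁ μ₂ e₀ he₀ hμ₁ h12 hμ₂
  have hK₁pos : 0 < K₁ := by linarith
  have hK₂0 : 0 < K₂ := by rw [hK₂]; positivity
  have hAf : 0 < Af := hcf.trans_le hcfA
  -- the cone radius
  set Φ₀ : ℝ := min (Φ / 2) (s₁ * Φ / (96 * (M₁ + 1))) with hΦ₀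
  have hΦ₀pos : 0 < Φ₀ := by rw [hΦ₀]; exact lt_min (by positivity) (by positivity)
  have h2Φ₀ : 2 * Φ₀ ≤ Φ := by have := min_le_left (Φ / 2) (s₁ * Φ / (96 * (M₁ + 1))); rw [← hΦ₀] at this; linarith
  have hΦ₀M : 12 * M₁ * Φ₀ ≤ s₁ * Φ / 8 := by
    have h1 : Φ₀ ≤ s₁ * Φ / (96 * (M₁ + 1)) := by rw [hΦ₀]; exact min_le_right _ _
    have h2 : 12 * (M₁ + 1) * (s₁ * Φ / (96 * (M₁ + 1))) = s₁ * Φ / 8 := by field_simp; ring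
    calc 12 * M₁ * Φ₀ ≤ 12 * (M₁ + 1) * Φ₀ := by nlinarith [hΦ₀pos.le]
      _ ≤ 12 * (M₁ + 1) * (s₁ * Φ / (96 * (M₁ + 1))) := mul_le_mul_of_nonneg_left h1 (by positivity)
      _ = s₁ * Φ / 8 := h2
  -- the `L`-growth constants of `L_Ψ` and `B_fib`
  set a₅ : ℝ := 1 + c₂ * (π / 2) / (K₁ * Φ₀) with ha₅
  have ha₅1 : 1 ≤ a₅ := by
    have h : 0 ≤ c₂ * (π / 2) / (K₁ * Φ₀) := by positivity
    rw [ha₅]; linarith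
  set a₆ : ℝ := max ((2 * ((2 * c₀ * K₂ * c₃ / π + 1) * a₅)) ^ 2) (4 * c₃ ^ 2 * K₂ ^ 2 / η₀ ^ 2 * a₅ ^ 2) with ha₆
  have ha₆0 : 0 ≤ a₆ := by rw [ha₆]; exact le_max_of_le_left (sq_nonneg _)
  -- the threshold
  set Q : ℝ := 1 / Φ₀ + c₃ / Φ₀ + K₂ * a₅ * c₃ / (c₂' * Φ₀) + 8 * (12 * c₃ + s₁ * π) / (s₁ * Φ) with hQ
  have hQ0 : 0 ≤ Q := by rw [hQ]; positivity
  -- the constant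
  set E₁ : ℝ := (16 * c₃ / (s₁ * π) + 1) * (3840 * Af * (8 * c₃ * (1 + Bf) + (4 * Bf + 1) * s₁ * π / 2) / (cf ^ 2 * s₁ ^ 2 * π ^ 2)) with hE₁
  have hE₁0 : 0 ≤ E₁ := by rw [hE₁]; positivity
  set E₂ : ℝ := (16 * c₃ / (s₁ * π) + 1) * (4 * (8 * M₁ * Φ₀ / (s₁ * π) + 1) +
      64 * c₃ * (1 + Bf) / (cf * s₁ ^ 2 * π ^ 2) * (16 * M₁ * Φ₀ / (s₁ * π) + 8 * c₃ / (s₁ * π) + 1)) with hE₂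
  have hE₂0 : 0 ≤ E₂ := by rw [hE₂]; positivity
  set cmain : ℝ := (4 * (2 * π / Φ₀ + 1) * (E₁ + E₂) + 1) * (128 * (2 * Φ₀ + 1)) + 384 * (a₆ + 1) with hcmain
  have hcmain0 : 0 < cmain := by rw [hcmain]; positivity
  set ccoarse : ℝ := 8 * (Q ^ 2 + 1) with hccoarse
  have hccoarse0 : 0 < ccoarse := by rw [hccoarse]; positivity
  refine ⟨κ, hκ, cmain + ccoarse, by positivity, ?_⟩
  intro K A hA hAκ μ hμ n' L E hE s hsE τ R
  set t : ℝ := (2 : ℝ) ^ n' with ht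
  have ht1 : 1 ≤ t := one_le_pow₀ (by norm_num)
  have ht0 : 0 < t := by positivity
  have hz : (2 : ℝ) ^ (-(n' : ℤ)) = t⁻¹ := two_zpow_neg_eq_inv_pow n'
  have ht3 : t ^ (L - E.card - 2) = (2 : ℝ) ^ (n' * (L - E.card - 2)) := by rw [ht, ← pow_mul]
  have hL1 : (1 : ℝ) ≤ L := by exact_mod_cast (show 1 ≤ L by omega)
  have hL0 : (0 : ℝ) < L := by linarith
  have hEL : (E.card : ℝ) ≤ L := by exact_mod_cast (show E.card ≤ L by omega)
  -- both partial constants are dominated by the total one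
  have hpow_main : cmain ^ L ≤ (cmain + ccoarse) ^ L := pow_le_pow_left₀ hcmain0.le (by linarith) L
  have hpow_coarse : ccoarse ^ L ≤ (cmain + ccoarse) ^ L := pow_le_pow_left₀ hccoarse0.le (by linarith) L
  by_cases hreg : Q * L ≤ t
  · -- the fine-scale regime
    set LΨ : ℝ := L + c₂ * (E.card * (π / 2)) / (K₁ * Φ₀) with hLΨ
    have hLΨa : LΨ ≤ a₅ * L := by
      have h0 : 0 ≤ c₂ * (π / 2) / (K₁ * Φ₀) := by positivity
      have h1 : c₂ * (E.card * (π / 2)) / (K₁ * Φ₀) ≤ c₂ * (π / 2) / (K₁ * Φ₀) * L := by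
        rw [show c₂ * (E.card * (π / 2)) / (K₁ * Φ₀) = c₂ * (π / 2) / (K₁ * Φ₀) * E.card by ring]
        exact mul_le_mul_of_nonneg_left hEL h0
      rw [hLΨ, ha₅]; linarith
    have hLΨ0 : 0 ≤ LΨ := by rw [hLΨ]; positivity
    set Bfib : ℝ := max ((2 * ((2 * c₀ * K₂ * c₃ / π + 1) * LΨ)) ^ 2) (4 * c₃ ^ 2 * K₂ ^ 2 / η₀ ^ 2 * LΨ ^ 2) with hBfib
    have hBfib_le : Bfib ≤ a₆ * (L : ℝ) ^ 2 := by
      rw [hBfib, ha₆]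
      refine max_le ?_ ?_
      · calc (2 * ((2 * c₀ * K₂ * c₃ / π + 1) * LΨ)) ^ 2 ≤ (2 * ((2 * c₀ * K₂ * c₃ / π + 1) * (a₅ * L))) ^ 2 := by
              apply pow_le_pow_left₀ (by positivity)
              exact mul_le_mul_of_nonneg_left (mul_le_mul_of_nonneg_left hLΨa (by positivity)) (by norm_num)
          _ = (2 * ((2 * c₀ * K₂ * c₃ / π + 1) * a₅)) ^ 2 * (L : ℝ) ^ 2 := by ring
          _ ≤ max ((2 * ((2 * c₀ * K₂ * c₃ / π + 1) * a₅)) ^ 2) (4 * c₃ ^ 2 * K₂ ^ 2 / η₀ ^ 2 * a₅ ^ 2) * (L : ℝ) ^ 2 :=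
              mul_le_mul_of_nonneg_right (le_max_left _ _) (by positivity)
      · calc 4 * c₃ ^ 2 * K₂ ^ 2 / η₀ ^ 2 * LΨ ^ 2 ≤ 4 * c₃ ^ 2 * K₂ ^ 2 / η₀ ^ 2 * (a₅ * L) ^ 2 :=
              mul_le_mul_of_nonneg_left (pow_le_pow_left₀ hLΨ0 hLΨa 2) (by positivity)
          _ = 4 * c₃ ^ 2 * K₂ ^ 2 / η₀ ^ 2 * a₅ ^ 2 * (L : ℝ) ^ 2 := by ring
          _ ≤ max ((2 * ((2 * c₀ * K₂ * c₃ / π + 1) * a₅)) ^ 2) (4 * c₃ ^ 2 * K₂ ^ 2 / η₀ ^ 2 * a₅ ^ 2) * (L : ℝ) ^ 2 :=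
              mul_le_mul_of_nonneg_right (le_max_right _ _) (by positivity)
    -- the four regime inequalities from the threshold
    have hQL1 : Q ≤ Q * L := le_mul_of_one_le_right hQ0 hL1
    have hQL : ∀ x : ℝ, 0 ≤ x → x ≤ Q → x ≤ t := fun x _ hxQ => by linarith
    have hq1 : 1 / Φ₀ ≤ Q := by
      have h : 0 ≤ c₃ / Φ₀ + K₂ * a₅ * c₃ / (c₂' * Φ₀) + 8 * (12 * c₃ + s₁ * π) / (s₁ * Φ) := by positivity
      rw [hQ]; linarith
    have hq2 : c₃ / Φ₀ ≤ Q := by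
      have h : 0 ≤ 1 / Φ₀ + K₂ * a₅ * c₃ / (c₂' * Φ₀) + 8 * (12 * c₃ + s₁ * π) / (s₁ * Φ) := by positivity
      rw [hQ]; linarith
    have hΦt : (2 : ℝ) ^ (-(n' : ℤ)) ≤ Φ₀ := by
      rw [hz, inv_le_comm₀ ht0 hΦ₀pos, ← one_div]; exact hQL _ (by positivity) hq1
    have hΦδ : c₃ * (2 : ℝ) ^ (-(n' : ℤ)) ≤ Φ₀ := by
      rw [hz, ← div_eq_mul_inv, div_le_iff₀ ht0]
      have h1 : c₃ / Φ₀ ≤ t := hQL _ (by positivity) hq2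
      rw [div_le_iff₀ hΦ₀pos] at h1; linarith
    have hΦη : K₂ * LΨ * (c₃ * (2 : ℝ) ^ (-(n' : ℤ))) ≤ c₂' * Φ₀ := by
      rw [hz]
      have h1 : K₂ * a₅ * c₃ / (c₂' * Φ₀) * L ≤ Q * L := by
        refine mul_le_mul_of_nonneg_right ?_ hL0.le
        have h : 0 ≤ 1 / Φ₀ + c₃ / Φ₀ + 8 * (12 * c₃ + s₁ * π) / (s₁ * Φ) := by positivity
        rw [hQ]; linarith
      have h2 : K₂ * a₅ * c₃ / (c₂' * Φ₀) * L ≤ t := h1.trans hreg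
      rw [div_mul_eq_mul_div, div_le_iff₀ (by positivity)] at h2
      rw [show K₂ * LΨ * (c₃ * t⁻¹) = K₂ * LΨ * c₃ / t by ring, div_le_iff₀ ht0]
      have h3 : K₂ * LΨ * c₃ ≤ K₂ * a₅ * c₃ * L := by
        have h4 := mul_le_mul_of_nonneg_right (mul_le_mul_of_nonneg_left hLΨa hK₂0.le) hc₃.le
        linarith [h4]
      linarith [h2, h3]
    have hreg' : 6 * (M₁ * (2 * Φ₀)) + 3 * (L * (4 * c₃ * (2 : ℝ) ^ (-(n' : ℤ)))) + 2 * (s₁ / 2 * sectorWidth n') ≤ s₁ / 4 * Φ := by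
      rw [hz, sectorWidth_eq_pi_div_pow, ← ht]
      have h1 : 8 * (12 * c₃ + s₁ * π) / (s₁ * Φ) * L ≤ t := by
        refine (mul_le_mul_of_nonneg_right ?_ hL0.le).trans hreg
        have h : 0 ≤ 1 / Φ₀ + c₃ / Φ₀ + K₂ * a₅ * c₃ / (c₂' * Φ₀) := by positivity
        rw [hQ]; linarith
      rw [div_mul_eq_mul_div, div_le_iff₀ (by positivity)] at h1
      have h2 : 6 * (M₁ * (2 * Φ₀)) + 3 * (L * (4 * c₃ * t⁻¹)) + 2 * (s₁ / 2 * (π / t)) = 12 * M₁ * Φ₀ + (12 * c₃ * L + s₁ * π) / t := by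
        field_simp; ring
      rw [h2]
      have h3 : (12 * c₃ * L + s₁ * π) / t ≤ s₁ * Φ / 8 := by
        rw [div_le_iff₀ ht0]
        have h4 : s₁ * π ≤ s₁ * π * L := le_mul_of_one_le_right (by positivity) hL1
        linarith [h4, h1]
      linarith [hΦ₀M, h3]
    have hmain := hcount K A hA hAκ μ hμ n' L E hE s hsE τ R Φ₀ LΨ Bfib hΦ₀pos h2Φ₀ hLΨ hΦt hΦδ hΦη (le_rfl : _ ≤ Bfib) hreg'
    have hbound := targetBound34_le_pow (n' := n') hE hc₃ hs₁ hcf hAf hBf hM₁ hΦ₀pos ha₆0 hBfib_le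
    refine (hmain.trans hbound).trans ?_
    exact mul_le_mul_of_nonneg_right (mul_le_mul_of_nonneg_right hpow_main (by positivity)) (by positivity)
  · -- the coarse regime: the trivial count of the free legs
    have htQ : t ≤ Q * L := (not_le.1 hreg).le
    have hall : (Nat.card {ω : Fin L → Fin (sectorCount n') |
          (∀ e ∈ E, ω e = τ e) ∧ ∃ k : Fin L → (Fin 2 → ℝ),
            (∀ i, k i ∈ BGM2003.sSector
              (fun ϑ e => perturbedFermiRadius (fun k : Fin 2 → ℝ => frameShift K (WithLp.toLp 2 k)) (μ + e) ϑ) e₀ n' (ω i : ℕ)) ∧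
            ∑ i, k i = R} : ℝ) ≤ (2 * t) ^ (L - E.card) := by
      have h1 := card_prescribed_le E τ (fun ω : Fin L → Fin (sectorCount n') => ∃ k : Fin L → (Fin 2 → ℝ),
            (∀ i, k i ∈ BGM2003.sSector
              (fun ϑ e => perturbedFermiRadius (fun k : Fin 2 → ℝ => frameShift K (WithLp.toLp 2 k)) (μ + e) ϑ) e₀ n' (ω i : ℕ)) ∧
            ∑ i, k i = R)
      have h2 : ((Nat.card {ω : Fin L → Fin (sectorCount n') |
          (∀ e ∈ E, ω e = τ e) ∧ ∃ k : Fin L → (Fin 2 → ℝ),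
            (∀ i, k i ∈ BGM2003.sSector
              (fun ϑ e => perturbedFermiRadius (fun k : Fin 2 → ℝ => frameShift K (WithLp.toLp 2 k)) (μ + e) ϑ) e₀ n' (ω i : ℕ)) ∧
            ∑ i, k i = R} : ℕ) : ℝ) ≤ ((sectorCount n' ^ (L - E.card) : ℕ) : ℝ) := by exact_mod_cast h1
      refine h2.trans_eq ?_
      push_cast
      rw [sectorCount_eq_two_mul_pow]
    have hc := coarse_bound_prescribed (by omega : E.card + 2 ≤ L) ht1 htQ
    have hn1 : (1 : ℝ) ≤ (n' : ℝ) + 1 := by have : (0 : ℝ) ≤ n' := Nat.cast_nonneg _; linarith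
    rw [← ht3]
    calc _ ≤ (2 * t) ^ (L - E.card) := hall
      _ ≤ (8 * (Q ^ 2 + 1)) ^ L * t ^ (L - E.card - 2) := hc
      _ ≤ (cmain + ccoarse) ^ L * t ^ (L - E.card - 2) := mul_le_mul_of_nonneg_right hpow_coarse (by positivity)
      _ = (cmain + ccoarse) ^ L * 1 * t ^ (L - E.card - 2) := by rw [mul_one]
      _ ≤ (cmain + ccoarse) ^ L * ((n' : ℝ) + 1) * t ^ (L - E.card - 2) := by gcongr

end Summit.HubbardSuperconductivity.HubbardSuperconductivity.Theorems.PerturbedFermiCurve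

end
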